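import Literature.MathematicalPhysics.QuantumLattice.LiebWuFiniteBCutoffSource
import HarnessLib

/-!
# Lieb–Wu 2003, Lemma 4 and Theorem 3 at fixed `B ≤ ∞` (monotonicity in `Q`)

Family `hubbard`. Lieb–Wu, Physica A 321 (2003) 1, §5: **LEMMA 4** ("Consider the dependence of the solution
… on `0 ≤ a ≤ 1` for fixed `B ≤ ∞` … as `Q` increases, `ρ(k)` increases for `0 ≤ |k| < π/2` and decreases
for `π/2 ≤ |k| ≤ π`; `σ(Λ)` increases for all real `Λ`") and **THEOREM 3** ("When `Q` increases with fixed
`B`, `N/N_a` and `M/N_a` increase. When `Q = π`, `N/N_a = 1` (for all `B`), while `N/N_a < 1` if `Q < π`").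
The tree has both at `B = ∞` (`liebWuSigmaAt_mono`, `liebWuFillingAtCutoff_strictMonoOn`) and the
`B`-independent clauses of Theorem 3 (`LiebWuMagnetizationMonotone`). Here, for every measurable range `S`
(in particular `S = [-B, B]`), from the source positivity of `LiebWuFiniteBCutoffSource` (the printed proof
differentiates in `a`; as at `B = ∞` the tree subtracts the fixed-point equations at two cutoffs instead):

* `liebWuSigmaAtS_mono_cutoff` (**Lemma 4, `σ`**): `0 < P ≤ R ≤ π ⇒ σ_{S,P} ≤ σ_{S,R}` pointwise, with
  `∫σ_{S,P} < ∫σ_{S,R}` for `P < R` (`liebWuSigmaAtS_le_of_lt`);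
* `liebWuG_mono_cutoff` (**Lemma 4, `f`**) and the `ρ` statement (rhoincr) at fixed `B`:
  `liebWuRhoAtS_mono_cutoff_of_cos_nonneg`, `liebWuRhoAtS_anti_cutoff_of_cos_nonpos`;
* **Theorem 3 at fixed `B`:** `M/N_a = ∫_S σ_{S,Q}` increases with `Q` (`liebWuDownSpin_mono_cutoff`) and
  `N/N_a = ∫σ_{S,Q} + ∫_S σ_{S,Q}` increases strictly (`liebWuFilling_liebWuRhoAtS_strictMonoOn_cutoff`);
  `IsLiebWuDensities` forms for arbitrary solutions with a common range.

No definition, no named fact.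

## References

* E. H. Lieb, F. Y. Wu, Physica A 321 (2003) 1–27 = arXiv:cond-mat/0207529, §5, Lemma 4, Theorem 3,
  eqs. (rhoincr), (mn) (key `LiebWuPhysicaA2003`); PRL 20 (1968) 1445, statement (c) (key `LiebWuPRL1968`).
-/

noncomputable section

open MeasureTheory Set Real Filter intervalIntegral
open Literature.Analysis.SpecialFunctions Literature.Analysis.FunctionSpaces

namespace Literature.MathematicalPhysics.QuantumLattice

variable {U P R : ℝ} {S : Set ℝ}

section Lemma4

/-- **Lemma 4 at fixed range, quantitative:** for `0 < P < R ≤ π` and measurable `S`, `σ_{S,P} ≤ σ_{S,R}`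
pointwise and `∫σ_{S,P} < ∫σ_{S,R}` (`δ = σ_{S,R} - σ_{S,P}` solves `δ - Ŵ_{S,P}δ = s > 0`).
[cite: LiebWuPhysicaA2003, §5, Lemma 4] -/
theorem liebWuSigmaAtS_le_of_lt (hU : 0 < U) (hS : MeasurableSet S) (hP : 0 < P) (hPR : P < R)
    (hRπ : R ≤ π) :
    (∀ x, liebWuSigmaAtS U P S x ≤ liebWuSigmaAtS U R S x) ∧
      ∫ x, liebWuSigmaAtS U P S x < ∫ x, liebWuSigmaAtS U R S x := by
  have hR0 : 0 < R := hP.trans hPR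
  have hσRi := integrable_liebWuSigmaAtS hU hR0 hS
  have hσPi := integrable_liebWuSigmaAtS hU hP hS
  have hσR0 : ∀ t, 0 ≤ liebWuSigmaAtS U R S t := fun t => (liebWuSigmaAtS_pos hU hR0 hS t).le
  have hhi : Integrable (S.indicator (liebWuSigmaAtS U R S)) := hσRi.indicator hS
  have hh0 : ∀ t, 0 ≤ S.indicator (liebWuSigmaAtS U R S) t := fun t => indicator_nonneg (fun s _ => hσR0 s) _
  have hδc : Continuous fun x => liebWuSigmaAtS U R S x - liebWuSigmaAtS U P S x :=
    (continuous_liebWuSigmaAtS hU hR0 hS).sub (continuous_liebWuSigmaAtS hU hP hS)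
  have hδi : Integrable fun x => liebWuSigmaAtS U R S x - liebWuSigmaAtS U P S x := hσRi.sub hσPi
  obtain ⟨hξRi, -⟩ := integrable_liebWuXi_and_integral hU hR0
  obtain ⟨hξPi, -⟩ := integrable_liebWuXi_and_integral hU hP
  obtain ⟨-, -, hWRi, -⟩ := liebWuW_props (Q := R) hU hhi hh0
  obtain ⟨-, -, hWPi, -⟩ := liebWuW_props (Q := P) hU hhi hh0
  -- the fixed-point relation `δ - Ŵ_{S,P} δ = s`
  have hsrc : ∀ x, (liebWuSigmaAtS U R S x - liebWuSigmaAtS U P S x) -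
      liebWuWS U P S (fun t => liebWuSigmaAtS U R S t - liebWuSigmaAtS U P S t) x =
      liebWuXi U R x - liebWuXi U P x +
        (liebWuW U R (S.indicator (liebWuSigmaAtS U R S)) x -
          liebWuW U P (S.indicator (liebWuSigmaAtS U R S)) x) := by
    intro x
    rw [← liebWuWS_sub hU hS hσRi hσPi, liebWuSigmaAtS_eq_xi_add_WS hU hR0 hS x,
      liebWuSigmaAtS_eq_xi_add_WS hU hP hS x, liebWuWS_eq_W_add_T U R, liebWuWS_eq_W_add_T U P S (liebWuSigmaAtS U R S)]
    ring
  have hspos : ∀ x, 0 < liebWuXi U R x - liebWuXi U P x +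
      (liebWuW U R (S.indicator (liebWuSigmaAtS U R S)) x -
        liebWuW U P (S.indicator (liebWuSigmaAtS U R S)) x) :=
    fun x => liebWuSigmaAtS_source_pos hU hP hPR hRπ hS x
  have hδ0 : ∀ x, 0 ≤ liebWuSigmaAtS U R S x - liebWuSigmaAtS U P S x :=
    nonneg_of_sub_liebWuWS_nonneg hU hS P hδc hδi (fun x => by rw [hsrc x]; exact (hspos x).le)
  refine ⟨fun x => sub_nonneg.1 (hδ0 x), ?_⟩
  obtain ⟨-, hWδ0, -, -, -⟩ := liebWuWS_props (Q := P) hU hS hδi hδ0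
  have hsi : Integrable fun x => liebWuXi U R x - liebWuXi U P x +
      (liebWuW U R (S.indicator (liebWuSigmaAtS U R S)) x -
        liebWuW U P (S.indicator (liebWuSigmaAtS U R S)) x) :=
    (hξRi.sub hξPi).add (hWRi.sub hWPi)
  have hint : 0 < ∫ x, (liebWuXi U R x - liebWuXi U P x +
      (liebWuW U R (S.indicator (liebWuSigmaAtS U R S)) x -
        liebWuW U P (S.indicator (liebWuSigmaAtS U R S)) x)) := by
    refine (integral_pos_iff_support_of_nonneg (fun x => (hspos x).le) hsi).2 ?_
    have hsupp : Function.support (fun x => liebWuXi U R x - liebWuXi U P x +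
        (liebWuW U R (S.indicator (liebWuSigmaAtS U R S)) x -
          liebWuW U P (S.indicator (liebWuSigmaAtS U R S)) x)) = univ :=
      eq_univ_of_forall fun x => Function.mem_support.2 (hspos x).ne'
    rw [hsupp, Real.volume_univ]
    simp
  have hmono := integral_mono hsi hδi fun x => by
    have h1 := hsrc x
    have h2 := hWδ0 x
    linarith
  rw [integral_sub hσRi hσPi] at hmono
  linarith

/-- **Lemma 4 (`σ`-part) for fixed `B ≤ ∞`: `σ_{S,Q}(Λ)` increases with `Q`** (`0 < P ≤ R ≤ π`, every real `Λ`,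
every measurable range `S`). [cite: LiebWuPhysicaA2003, §5, Lemma 4] -/
theorem liebWuSigmaAtS_mono_cutoff (hU : 0 < U) (hS : MeasurableSet S) (hP : 0 < P) (hPR : P ≤ R)
    (hRπ : R ≤ π) (x : ℝ) : liebWuSigmaAtS U P S x ≤ liebWuSigmaAtS U R S x := by
  rcases eq_or_lt_of_le hPR with h | h
  · rw [h]
  · exact (liebWuSigmaAtS_le_of_lt hU hS hP h hRπ).1 x

/-- **Lemma 4 (`f`-part) for fixed `B ≤ ∞`: `G_{S,Q} = K ∗ (1_S σ_{S,Q}) = f - t` increases with `Q`.**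
[cite: LiebWuPhysicaA2003, §5, Lemma 4] -/
theorem liebWuG_mono_cutoff (hU : 0 < U) (hS : MeasurableSet S) (hP : 0 < P) (hPR : P ≤ R) (hRπ : R ≤ π)
    (y : ℝ) : liebWuG U P S y ≤ liebWuG U R S y := by
  have hR0 : 0 < R := hP.trans_le hPR
  rw [liebWuG, liebWuG]
  exact conv_cauchyDensity_mono hU ((integrable_liebWuSigmaAtS hU hP hS).indicator hS)
    ((integrable_liebWuSigmaAtS hU hR0 hS).indicator hS)
    (fun t => indicator_le_indicator (liebWuSigmaAtS_mono_cutoff hU hS hP hPR hRπ t)) y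

/-- **(rhoincr) at fixed `B`, `cos k ≥ 0`:** `ρ_{S,Q}(k)` increases with `Q`. [cite: LiebWuPhysicaA2003, §5, Lemma 4] -/
theorem liebWuRhoAtS_mono_cutoff_of_cos_nonneg (hU : 0 < U) (hS : MeasurableSet S) (hP : 0 < P)
    (hPR : P ≤ R) (hRπ : R ≤ π) {k : ℝ} (hk : 0 ≤ Real.cos k) :
    liebWuRhoAtS U P S k ≤ liebWuRhoAtS U R S k := by
  rw [liebWuRhoAtS_eq, liebWuRhoAtS_eq]
  exact add_le_add le_rfl (mul_le_mul_of_nonneg_left (liebWuG_mono_cutoff hU hS hP hPR hRπ _) hk)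

/-- **(rhoincr) at fixed `B`, `cos k ≤ 0`:** `ρ_{S,Q}(k)` decreases with `Q`. [cite: LiebWuPhysicaA2003, §5, Lemma 4] -/
theorem liebWuRhoAtS_anti_cutoff_of_cos_nonpos (hU : 0 < U) (hS : MeasurableSet S) (hP : 0 < P)
    (hPR : P ≤ R) (hRπ : R ≤ π) {k : ℝ} (hk : Real.cos k ≤ 0) :
    liebWuRhoAtS U R S k ≤ liebWuRhoAtS U P S k := by
  rw [liebWuRhoAtS_eq, liebWuRhoAtS_eq]
  exact add_le_add le_rfl (mul_le_mul_of_nonpos_left (liebWuG_mono_cutoff hU hS hP hPR hRπ _) hk)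

end Lemma4

section Theorem3

/-- **Theorem 3 at fixed `B`, `M/N_a`:** `M/N_a = ∫_S σ_{S,Q}` increases with `Q` (`0 < P ≤ R ≤ π`).
[cite: LiebWuPhysicaA2003, §5, Theorem 3] -/
theorem liebWuDownSpin_mono_cutoff (hU : 0 < U) (hS : MeasurableSet S) (hP : 0 < P) (hPR : P ≤ R)
    (hRπ : R ≤ π) :
    liebWuDownSpinDensity S (liebWuSigmaAtS U P S) ≤ liebWuDownSpinDensity S (liebWuSigmaAtS U R S) :=
  setIntegral_mono_on (integrable_liebWuSigmaAtS hU hP hS).integrableOn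
    (integrable_liebWuSigmaAtS hU (hP.trans_le hPR) hS).integrableOn hS
    fun x _ => liebWuSigmaAtS_mono_cutoff hU hS hP hPR hRπ x

/-- **Theorem 3 at fixed `B`, `N/N_a`, strict:** `0 < P < R ≤ π ⇒ N/N_a(S, P) < N/N_a(S, R)`
(`N/N_a = ∫σ_{S,Q} + ∫_S σ_{S,Q}`, eq. (mn)). [cite: LiebWuPhysicaA2003, §5, Theorem 3] -/
theorem liebWuFilling_liebWuRhoAtS_lt_of_lt (hU : 0 < U) (hS : MeasurableSet S) (hP : 0 < P) (hPR : P < R)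
    (hRπ : R ≤ π) : liebWuFilling P (liebWuRhoAtS U P S) < liebWuFilling R (liebWuRhoAtS U R S) := by
  rw [liebWuFilling_eq_integral_add_downSpin hU hP (hPR.le.trans hRπ) hS,
    liebWuFilling_eq_integral_add_downSpin hU (hP.trans hPR) hRπ hS]
  exact add_lt_add_of_lt_of_le (liebWuSigmaAtS_le_of_lt hU hS hP hPR hRπ).2
    (liebWuDownSpin_mono_cutoff hU hS hP hPR.le hRπ)

/-- **Theorem 3 at fixed `B ≤ ∞`: "when `Q` increases with fixed `B`, `N/N_a` increases"** — strictly, on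
`0 < Q ≤ π`, for every measurable range `S`. [cite: LiebWuPhysicaA2003, §5, Theorem 3] -/
theorem liebWuFilling_liebWuRhoAtS_strictMonoOn_cutoff (hU : 0 < U) (hS : MeasurableSet S) :
    StrictMonoOn (fun Q => liebWuFilling Q (liebWuRhoAtS U Q S)) (Ioc 0 π) :=
  fun _ hP _ hR hPR => liebWuFilling_liebWuRhoAtS_lt_of_lt hU hS hP.1 hPR hR.2

/-- **Theorem 3 at fixed `B ≤ ∞`: "… and `M/N_a` increase[s]"** — on `0 < Q ≤ π`, every measurable range.
[cite: LiebWuPhysicaA2003, §5, Theorem 3] -/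
theorem liebWuDownSpin_monotoneOn_cutoff (hU : 0 < U) (hS : MeasurableSet S) :
    MonotoneOn (fun Q => liebWuDownSpinDensity S (liebWuSigmaAtS U Q S)) (Ioc 0 π) :=
  fun _ hP _ hR hPR => liebWuDownSpin_mono_cutoff hU hS hP.1 hPR hR.2

end Theorem3

section Solutions

variable {Q₁ Q₂ : ℝ} {SΛ : Set ℝ} {ρ₁ σ₁ ρ₂ σ₂ : ℝ → ℝ}

/-- An admissible rapidity range (`[-B, B]` or `ℝ`) is measurable. [folklore] -/
private theorem measurableSet_of_range₁ {SΛ : Set ℝ} (h : (∃ B : ℝ, 0 < B ∧ SΛ = Icc (-B) B) ∨ SΛ = univ) :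
    MeasurableSet SΛ := by
  rcases h with ⟨B, _, rfl⟩ | rfl
  · exact measurableSet_Icc
  · exact MeasurableSet.univ

/-- **Lemma 4 / Theorem 3 for arbitrary solutions with a common range:** if `(ρ₁, σ₁)` and `(ρ₂, σ₂)` solve
the Lieb–Wu equations at `(U, Q₁, SΛ)` and `(U, Q₂, SΛ)` with `Q₁ ≤ Q₂`, then `σ₁ ≤ σ₂` on `SΛ`,
`M/N_a(1) ≤ M/N_a(2)` and `N/N_a(1) ≤ N/N_a(2)` (`<` if `Q₁ < Q₂`). [cite: LiebWuPhysicaA2003, §5, Theorem 3] -/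
theorem IsLiebWuDensities.mono_cutoff (hU : 0 < U) (h₁ : IsLiebWuDensities U Q₁ SΛ ρ₁ σ₁)
    (h₂ : IsLiebWuDensities U Q₂ SΛ ρ₂ σ₂) (hQ : Q₁ ≤ Q₂) :
    (∀ Λ ∈ SΛ, σ₁ Λ ≤ σ₂ Λ) ∧ liebWuDownSpinDensity SΛ σ₁ ≤ liebWuDownSpinDensity SΛ σ₂ ∧
      liebWuFilling Q₁ ρ₁ ≤ liebWuFilling Q₂ ρ₂ ∧ (Q₁ < Q₂ → liebWuFilling Q₁ ρ₁ < liebWuFilling Q₂ ρ₂) := by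
  have hS := measurableSet_of_range₁ h₁.range_eq
  obtain ⟨hf₁, -, hd₁⟩ := IsLiebWuDensities.functionals_unique_on hU hS h₁
    (isLiebWuDensities_liebWuRhoAtS_of_range hU h₁.cutoff_pos h₁.cutoff_le_pi h₁.range_eq)
  obtain ⟨hf₂, -, hd₂⟩ := IsLiebWuDensities.functionals_unique_on hU hS h₂
    (isLiebWuDensities_liebWuRhoAtS_of_range hU h₂.cutoff_pos h₂.cutoff_le_pi h₂.range_eq)
  refine ⟨fun Λ hΛ => ?_, ?_, ?_, fun hlt => ?_⟩
  · rw [(h₁.eq_neumann_of_range hU).1 Λ hΛ, (h₂.eq_neumann_of_range hU).1 Λ hΛ]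
    exact liebWuSigmaAtS_mono_cutoff hU hS h₁.cutoff_pos hQ h₂.cutoff_le_pi Λ
  · rw [hd₁, hd₂]; exact liebWuDownSpin_mono_cutoff hU hS h₁.cutoff_pos hQ h₂.cutoff_le_pi
  · rw [hf₁, hf₂]
    rcases eq_or_lt_of_le hQ with h | h
    · subst h; exact le_rfl
    · exact (liebWuFilling_liebWuRhoAtS_lt_of_lt hU hS h₁.cutoff_pos h h₂.cutoff_le_pi).le
  · rw [hf₁, hf₂]; exact liebWuFilling_liebWuRhoAtS_lt_of_lt hU hS h₁.cutoff_pos hlt h₂.cutoff_le_pi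

end Solutions

end Literature.MathematicalPhysics.QuantumLattice

end
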